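import Summits.QuantumFields.YangMills.Theorems.BalabanUVNodesK0RecordFormatNamesFluctQtC
import Summits.QuantumFields.YangMills.Theorems.BalabanUVNodesK0RecordFormatNamesFluctHopC

/-!
# K0⁷ — THE RECORD-SIDE FORMAT NAMES, EDITION 33 = (M1-c) THE COMPLEX-DATUM TWINS: `Q̃`, `LQ̃`, `C̃`, `A₁`, `A₂`, `X`, `C_loc` OVER A COMPLEX BACKGROUND FIELD `V : PBond → M₂(ℂ)`
# (▶ PT-A-1 g10 ask (A2), nodeO STATUS 2026-08-31 l.5953: «edition (M1-c) complex-DATUM twins `recordQtCC (V : PBond → MatA 2) z`∕`recordLQtCC`∕`recordCopLocC` (I supply the `coeField Vk` bridges)»;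
# ★★★ director-ym №589: «(M1-c) complex `C_loc` = DEF-1's names»)

Cell `ym-nodeO-ideate` ∕ `ym-balaban-port`, DEFINER seat `ym-nodeO-def-1` (gen 39); `--kind definition --supports stmt-QuantumFields-20541 --as helper`; count-neutral.
[I] = [Balaban1987RG1], [15] = [Balaban1985Variational].

WHY.  The `stub_P0C` supplier road (▶ PT-A-1's `P0C-SUPPLY-OWNER-v1.md` §1: `T = 𝟙_X·C_loc(V)ᵀ·Δ^{(k)}_X(𝐔)·C_loc(V)·𝟙_X` with `V = M^k_h(𝐔)` a COMPLEX background) needs ed.29's complexified constraint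
(`recordQtC Vk z`, background `Vk : SU(2)`-valued) one step further: the BACKGROUND itself complex ([15] Prop. 9's `Gᶜ`-valued configurations).  This file mints those «CC» twins —
formulas identical to ed.29∕ed.15d∕ed.15e with `↑Vk ↦ V : PBond (F.P K) k → MatA 2` and `(↑(Ū Vk c))⋆ ↦ (avgMh V c)⁻¹` (matrix inverse — the holomorphic twin of the unitary `⋆`; junk SAID).

WHAT THIS FILE IS (definitions + `rfl` faces; NEW names; nothing earlier touched):
* §24s `pertCC V z := (b ↦ exp(fluctMatC z b) · V b)` (`pertCC (coeField Vk) = pertC Vk`, `rfl`); ★ `recordQtCC V z c := mlog( avgMh (pertCC V z) c · (avgMh V c)⁻¹ )`; `recordLQtCC V := fderiv ℂ (recordQtCC V) 0`;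
  ★ `recordCtCC V z := recordQtCC V z − recordLQtCC V z`; the coordinate matrices `recordLQtMatCC V : Matrix (CoarseIdx) (FluctIdx) ℂ` (entries `su2CoordCt (recordLQtCC V (Pi.single i 1) c) j`),
  `recordLQtB0CC`, `recordLQtOffCC`, `recordXLocCC := (recordLQtB0CC)⁻¹ * recordLQtOffCC`, ★ `recordCopLocCC := fromRows (−recordXLocCC) 1` — ed.15d∕15e's `recordLQtMat∕recordLQtB0∕recordLQtOff∕
  recordXLoc∕recordCopLoc` VERBATIM over ℂ with `su2Coord ↦ su2CoordCt` (▶ PT-A-1's trace-projected reader) and `Vk ↦ V`.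
NOT HERE (▶ PT-A-1's, per their (A2)): the `coeField Vk` bridges (`recordQtCC (coeField Vk) = recordQtC Vk` under the guard, `recordLQtMatCC (coeField Vk) = ↑recordLQtMat Vk`, …), analyticity in
`(V, z)`, invertibility of `recordLQtB0CC`, any estimate.

HONEST FRAMING.  Definitions only; NOTHING of Bałaban ∕ [15] Prop. 9 asserted, ported or discharged; JUNK (said): `mlog` off the log-disc, `avgMh` adjugates off the guard, matrix inverses
`0`-junk when singular; `stub_P0C`∕`stub_FE` OPEN, ⟨27930⟩ OPEN (1∕3); K0⁷ ∕ K0ᴬ ∕ K1ᴬ ∕ K3ᴬ OPEN; NODE O 0∕1; COUNT 8∕28 · K 1∕4 UNMOVED; finite `𝕋⁴_{L^K}` at fixed ε — NOT continuum ∕ ℝ⁴ ∕ OS;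
**the Yang–Mills mass gap (Clay) is NOT proved by any of this.**  No `sorry`, `instance`, `notation`; standard axioms.
-/

noncomputable section

open scoped BigOperators Matrix.Norms.L2Operator

namespace Summit.QuantumFields.YangMills.Theorems.K0RecordFormatNames

open Literature.MathematicalPhysics.QuantumFieldTheory.Balaban1983to89
open Literature.MathematicalPhysics.QuantumFieldTheory.Balaban1983to89.Node00
open Literature.MathematicalPhysics.QuantumFieldTheory.Balaban1983to89.T4Continuum (T4Family)
open NormedSpace (exp)
open B15AveragingHolomorphic (avgMh)
open Summit.QuantumFields.YangMills.Theorems.BalabanUVNodesPortS1 (su2CoordCt)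
open _root_.Matrix

variable (F : T4Family)

/-! ## §24s  The complex-datum twins -/

/-- **The chart over a COMPLEX background**: `pertCC V z := (b ↦ exp(fluctMatC z b) · V b)`. [cite: Balaban1987RG1, (2.4) p.266; Balaban1985Variational, Prop. 9 p.309] -/
def pertCC (k K : ℕ) (V : PBond (F.P K) k → MatA 2) (z : FluctIdx F k K → ℂ) : PBond (F.P K) k → MatA 2 :=
  fun b => exp (fluctMatC F k K z b) * V b

/-- At an `SU(2)`-valued background the complex-datum chart IS ed.29's `pertC` (`rfl`). [cite: Balaban1987RG1, (2.4) p.266 (bookkeeping)] -/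
theorem pertCC_coeField (k K : ℕ) (Vk : GaugeField (F.P K) k (SU 2)) (z : FluctIdx F k K → ℂ) :
    pertCC F k K (coeField Vk) z = pertC F k K Vk z := rfl

/-- `pertCC V 0 = V`. [cite: Balaban1987RG1, (2.4) p.266 (bookkeeping)] -/
theorem pertCC_zero (k K : ℕ) (V : PBond (F.P K) k → MatA 2) : pertCC F k K V 0 = V := by
  funext b
  rw [pertCC, fluctMatC_zero, NormedSpace.exp_zero, one_mul]

/-- ★ **`Q̃` OVER A COMPLEX BACKGROUND**: `recordQtCC V z c := mlog( avgMh (pertCC V z) c · (avgMh V c)⁻¹ )` — ed.29's `recordQtC` with the unitary `⋆` replaced by the matrix inverse of the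
holomorphic average of the complex background (junk `0`-inverse when singular — SAID). [cite: Balaban1987RG1, (2.4) p.266, p.267; Balaban1985Variational, Prop. 9 p.309] -/
def recordQtCC (k K : ℕ) (V : PBond (F.P K) k → MatA 2) (z : FluctIdx F k K → ℂ) : PBond (F.P K) (k + 1) → MatA 2 :=
  fun c => MatrixLog.mlog (avgMh (pertCC F k K V z) c * (avgMh V c)⁻¹)

/-- Unfolding (`rfl`). [cite: Balaban1987RG1, (2.4) p.266 (bookkeeping)] -/
theorem recordQtCC_apply (k K : ℕ) (V : PBond (F.P K) k → MatA 2) (z : FluctIdx F k K → ℂ) (c : PBond (F.P K) (k + 1)) :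
    recordQtCC F k K V z c = MatrixLog.mlog (avgMh (pertCC F k K V z) c * (avgMh V c)⁻¹) := rfl

/-- **`LQ̃` over a complex background**: `recordLQtCC V := fderiv ℂ (recordQtCC V) 0`. [cite: Balaban1987RG1, p.267] -/
def recordLQtCC (k K : ℕ) (V : PBond (F.P K) k → MatA 2) : (FluctIdx F k K → ℂ) →L[ℂ] (PBond (F.P K) (k + 1) → MatA 2) :=
  fderiv ℂ (recordQtCC F k K V) 0

/-- ★ **`C̃` over a complex background**: `recordCtCC V z := recordQtCC V z − recordLQtCC V z`. [cite: Balaban1987RG1, p.267, (1.5) p.261] -/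
def recordCtCC (k K : ℕ) (V : PBond (F.P K) k → MatA 2) (z : FluctIdx F k K → ℂ) : PBond (F.P K) (k + 1) → MatA 2 :=
  recordQtCC F k K V z - recordLQtCC F k K V z

/-- FACE: `Q̃ = LQ̃ + C̃` (by construction). [cite: Balaban1987RG1, p.267 (bookkeeping)] -/
theorem recordLQtCC_add_recordCtCC (k K : ℕ) (V : PBond (F.P K) k → MatA 2) (z : FluctIdx F k K → ℂ) :
    recordLQtCC F k K V z + recordCtCC F k K V z = recordQtCC F k K V z := by
  rw [recordCtCC, add_sub_cancel]

/-- **The complex matrix of `LQ̃(V)`** in ▶ PT-A-1's trace-projected coordinates: entry `((c, j), i) := su2CoordCt (LQ̃_V e_i c) j` (ed.15d's `recordLQtMat` over ℂ).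
[cite: Balaban1987RG1, p.267 («L is a linear transformation»)] -/
def recordLQtMatCC (k K : ℕ) (V : PBond (F.P K) k → MatA 2) : Matrix (CoarseIdx F k K) (FluctIdx F k K) ℂ :=
  fun cj i => su2CoordCt (recordLQtCC F k K V (Pi.single i 1) cj.1) cj.2

/-- **The `b₀`-block `A₁(V)`** (ed.15d's `recordLQtB0` over ℂ). [cite: Balaban1987RG1, p.267–268] -/
def recordLQtB0CC (k K : ℕ) (V : PBond (F.P K) k → MatA 2) : Matrix (CoarseIdx F k K) (CoarseIdx F k K) ℂ :=
  fun cj c'j' => recordLQtMatCC F k K V cj (recordB0 F k K c'j'.1, c'j'.2)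

/-- **The off-block `A₂(V)`** (ed.15e's `recordLQtOff` over ℂ). [cite: Balaban1987RG1, p.267–268] -/
def recordLQtOffCC (k K : ℕ) (V : PBond (F.P K) k → MatA 2) : Matrix (CoarseIdx F k K) (NonB0Idx F k K) ℂ :=
  fun cj i => recordLQtMatCC F k K V cj i.1

open Classical in
/-- **`X(V) = A₁⁻¹A₂`** (nonsingular inverse; junk `0`-inverse when `A₁(V)` is singular — SAID). [cite: Balaban1987RG1, p.267 («LQ̃h = I»)] -/
def recordXLocCC (k K : ℕ) (V : PBond (F.P K) k → MatA 2) : Matrix (CoarseIdx F k K) (NonB0Idx F k K) ℂ :=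
  (recordLQtB0CC F k K V)⁻¹ * recordLQtOffCC F k K V

open Classical in
/-- ★ **`C_loc(V) := [−A₁⁻¹A₂; 1]`** — the linear parametrisation `B′ = C(V)B` of `{LQ̃_V B′ = 0}` by the remaining variables, over a COMPLEX background (ed.15e's `recordCopLoc` over ℂ;
▶ PT-A-1's §1 `T = 𝟙_X·C_loc(V)ᵀ·Δ^{(k)}_X·C_loc(V)·𝟙_X`). [cite: Balaban1987RG1, p.268 («B′ = CB»); Balaban1985Variational, Prop. 9 p.309] -/
def recordCopLocCC (k K : ℕ) (V : PBond (F.P K) k → MatA 2) : Matrix (CoarseIdx F k K ⊕ NonB0Idx F k K) (NonB0Idx F k K) ℂ :=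
  fromRows (-(recordXLocCC F k K V)) 1

/-- FACE (`rfl`): the lower block of `C_loc(V)` is the identity (the remaining variables are kept). [cite: Balaban1987RG1, p.268 (bookkeeping)] -/
theorem recordCopLocCC_inr (k K : ℕ) (V : PBond (F.P K) k → MatA 2) (i j : NonB0Idx F k K) :
    recordCopLocCC F k K V (Sum.inr i) j = (1 : Matrix (NonB0Idx F k K) (NonB0Idx F k K) ℂ) i j := by
  simp [recordCopLocCC]

/-- FACE (`rfl`): the upper block of `C_loc(V)` is `−X(V)`. [cite: Balaban1987RG1, p.268 (bookkeeping)] -/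
theorem recordCopLocCC_inl (k K : ℕ) (V : PBond (F.P K) k → MatA 2) (cj : CoarseIdx F k K) (j : NonB0Idx F k K) :
    recordCopLocCC F k K V (Sum.inl cj) j = -(recordXLocCC F k K V cj j) := by
  simp [recordCopLocCC]

end Summit.QuantumFields.YangMills.Theorems.K0RecordFormatNames

end
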